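import Literature.Topology.FourManifolds.SlideDiffeomorphism
import Literature.Topology.FourManifolds.PointPushDisc
import Literature.Topology.FourManifolds.PathAvoidPoints
import Literature.Topology.FourManifolds.OneHandleStepMatch
import HarnessLib

/-!
# The seed diffeotopy of a handle slide: pushing one foot around a prescribed loop

Topic `Literature/Topology/FourManifolds` (fact seat
`provefact-Literature.Topology.FourManifolds.lauden-f709dd520c`, Laudenbach–Poénaru's Lemma 2,
the slide `H₃`, p. 340: one foot of the top `1`-handle is pushed once around a loop in the level
below the handle).  Everything here is **proved**; no named facts.

**Theorem** (`SlideContext.exists_isSeed_homotopic`).  Let `C` be a slide context on a compact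
manifold (`SlideContext.lean`) with seed level `V = f⁻¹(c)` (connected, of dimension `n ≥ 2`),
`v₊`, `v₋` the centres of the two flowed-down feet discs, `u` any point of `V` and `β` any loop
of `V` at `v₊`.  Then there is a diffeotopy `ψ` of `V` which is a seed (`SlideContext.IsSeed`:
its final stage fixes both discs on their closed unit balls), all of whose stages fix `v₋`,
whose final stage fixes `u`, and whose track of `v₊` is homotopic in `V` to `β` — hence
(`SlideDiffeomorphism.lean`) the loop `levelTrack ψ` is homotopic in `M` to `β`.  Proof: move
`β` off `v₋` (and off `u` when `u` is not in the range of the `+` disc; general position,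
`PathAvoidPoints.lean`), then off the closed `-` disc — enlarged so as to contain `u` when `u`
lies in the range of the `-` disc (`Path.exists_homotopic_disjoint_image_closedBall`,
`PointPushDisc.lean`), and push `v₊` around the resulting loop with
`exists_diffeotopy_pointPush_closedBall` applied to the `+` disc — enlarged so as to contain
`u` when `u` lies in its range — inside the complement of the `-` disc (and of `u`).

## References

* F. Laudenbach, V. Poénaru, *A note on 4-dimensional handlebodies*, Bull. Soc. Math. France
  100 (1972), proof of Lemma 2 (p. 340). [LaudenbachPoenaruBSMF1972]
* M. W. Hirsch, *Differential Topology* (1976), Ch. 8 §1 Thm. 1.3, §3 Thm. 3.1. [HirschDT1976]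
-/

open scoped Manifold ContDiff Topology unitInterval
open Set Function Filter Metric Module

noncomputable section

namespace Literature.Topology.FourManifolds

universe u

/-- Local notation: `𝔼 n` is the model Euclidean space `EuclideanSpace ℝ (Fin n)`. -/
local notation "𝔼 " n:arg => EuclideanSpace ℝ (Fin n)

/-! ### Enlarging a disc -/

section Enlarge

variable {n : ℕ} {V : Type*} [TopologicalSpace V] [ChartedSpace (𝔼 n) V] [IsManifold (𝓡 n) ∞ V]

/-- **The scaling `w ↦ R w` of the parameter space**, `R ≠ 0`, as a continuous linear
equivalence: Mathlib's `ContinuousLinearEquiv.smulLeft (Units.mk0 R hR)`. [folklore] -/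
abbrev scaleCLE (n : ℕ) {R : ℝ} (hR : R ≠ 0) : 𝔼 n ≃L[ℝ] 𝔼 n :=
  ContinuousLinearEquiv.smulLeft (M₁ := 𝔼 n) (R₁ := ℝ) (Units.mk0 R hR)

/-- The scaling, evaluated. [folklore] -/
@[simp] theorem scaleCLE_apply {R : ℝ} (hR : R ≠ 0) (w : 𝔼 n) : scaleCLE n hR w = R • w := by
  rw [scaleCLE, ContinuousLinearEquiv.smulLeft_apply_apply, Units.smul_def, Units.val_mk0]

omit [IsManifold (𝓡 n) ∞ V] in
/-- **An enlarged disc is a smooth embedding.** [cite: LeeSmoothManifolds2013, Prop. 5.2] -/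
theorem isSmoothEmbedding_comp_scale {i : 𝔼 n → V} (hi : Manifold.IsSmoothEmbedding 𝓘(ℝ, 𝔼 n) (𝓡 n) ∞ i)
    {R : ℝ} (hR : R ≠ 0) : Manifold.IsSmoothEmbedding 𝓘(ℝ, 𝔼 n) (𝓡 n) ∞ (i ∘ scaleCLE n hR) :=
  hi.comp_openPartialHomeomorph (scaleCLE n hR).toHomeomorph.toOpenPartialHomeomorph (by simp)
    (scaleCLE n hR).contDiff.contMDiff.contMDiffOn (scaleCLE n hR).symm.contDiff.contMDiff.contMDiffOn

omit [TopologicalSpace V] [ChartedSpace (𝔼 n) V] [IsManifold (𝓡 n) ∞ V] in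
/-- The range of an enlarged disc is the range of the disc. [folklore] -/
theorem range_comp_scale (i : 𝔼 n → V) {R : ℝ} (hR : R ≠ 0) : range (i ∘ scaleCLE n hR) = range i :=
  (scaleCLE n hR).surjective.range_comp i

omit [TopologicalSpace V] [ChartedSpace (𝔼 n) V] [IsManifold (𝓡 n) ∞ V] in
/-- The closed unit ball of the enlarged disc contains the closed unit ball of the disc
(`1 ≤ R`). [folklore] -/
theorem image_closedBall_subset_image_comp_scale (i : 𝔼 n → V) {R : ℝ} (hR : 1 ≤ R) :
    i '' closedBall 0 1 ⊆ (i ∘ scaleCLE n (by linarith : R ≠ 0)) '' closedBall 0 1 := by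
  rintro _ ⟨w, hw, rfl⟩
  refine ⟨R⁻¹ • w, ?_, ?_⟩
  · rw [mem_closedBall_zero_iff] at hw ⊢
    rw [norm_smul, Real.norm_eq_abs, abs_inv, abs_of_pos (by linarith)]
    exact (mul_le_mul_of_nonneg_left hw (by positivity)).trans (by rw [mul_one]; exact inv_le_one_of_one_le₀ hR)
  · show i (R • (R⁻¹ • w)) = i w
    rw [smul_smul, mul_inv_cancel₀ (by linarith), one_smul]

omit [TopologicalSpace V] [ChartedSpace (𝔼 n) V] [IsManifold (𝓡 n) ∞ V] in
/-- A point `i w` lies in the closed unit ball of the disc enlarged by `R ≥ ‖w‖`, `R ≥ 1`. [folklore] -/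
theorem apply_mem_image_comp_scale (i : 𝔼 n → V) {R : ℝ} (hR : 1 ≤ R) {w : 𝔼 n} (hw : ‖w‖ ≤ R) :
    i w ∈ (i ∘ scaleCLE n (by linarith : R ≠ 0)) '' closedBall 0 1 := by
  refine ⟨R⁻¹ • w, ?_, ?_⟩
  · rw [mem_closedBall_zero_iff, norm_smul, Real.norm_eq_abs, abs_inv, abs_of_pos (by linarith)]
    rw [inv_mul_le_iff₀ (by linarith), mul_one]; exact hw
  · show i (R • (R⁻¹ • w)) = i w
    rw [smul_smul, mul_inv_cancel₀ (by linarith), one_smul]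

end Enlarge

/-! ### The seed of a slide -/

namespace SlideContext

variable {n : ℕ} {M : Type u} [TopologicalSpace M] [ChartedSpace (EuclideanHalfSpace (n + 1)) M]
  [IsManifold (𝓡∂ (n + 1)) ∞ M] [T2Space M] [CompactSpace M] (C : SlideContext n M)

/-- **The seed diffeotopy of a slide** (see the module docstring). [cite: LaudenbachPoenaruBSMF1972, proof of Lemma 2 (p. 340)]
[cite: HirschDT1976, Ch. 8 §1, Thm. 1.3; Ch. 8 §3, Thm. 3.1] -/
theorem exists_isSeed_homotopic (u : C.toCtx.Sl'.Level (C.toCtx.c + C.toCtx.σ))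
    (β : Path (C.toCtx.disc' (one_pow 2) 0) (C.toCtx.disc' (one_pow 2) 0)) :
    ∃ ψ : Diffeotopy (𝓡 n) (C.toCtx.Sl'.Level (C.toCtx.c + C.toCtx.σ)),
      C.IsSeed ψ ∧ (∀ s, ψ.toFun s (C.toCtx.disc' neg_one_sq 0) = C.toCtx.disc' neg_one_sq 0) ∧
      ψ.toFun 1 u = u ∧ ψ.toFun 1 (C.toCtx.disc' (one_pow 2) 0) = C.toCtx.disc' (one_pow 2) 0 ∧
      ∃ β' : Path (C.toCtx.disc' (one_pow 2) 0) (C.toCtx.disc' (one_pow 2) 0),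
        (∀ s, β' s = ψ.toFun s (C.toCtx.disc' (one_pow 2) 0)) ∧ β'.Homotopic β := by
  have hipE := C.toCtx.isSmoothEmbedding_disc' (one_pow 2)
  have himE := C.toCtx.isSmoothEmbedding_disc' neg_one_sq
  have hdisj : Disjoint (range (C.toCtx.disc' (one_pow 2))) (range (C.toCtx.disc' neg_one_sq)) := C.toCtx.disjoint_range_disc'
  have hn := C.hn
  haveI : ConnectedSpace (C.toCtx.Sl'.Level (C.toCtx.c + C.toCtx.σ)) := C.toCtx.connectedSpace_levelC'
  -- the scales of the two discs, so that their closed unit balls contain `u` when it lies in their ranges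
  classical
  set Rp : ℝ := if h : u ∈ range (C.toCtx.disc' (one_pow 2)) then max 1 ‖h.choose‖ else 1 with hRp
  set Rm : ℝ := if h : u ∈ range (C.toCtx.disc' neg_one_sq) then max 1 ‖h.choose‖ else 1 with hRm
  have hRp1 : 1 ≤ Rp := by rw [hRp]; split_ifs <;> simp
  have hRm1 : 1 ≤ Rm := by rw [hRm]; split_ifs <;> simp
  have hRp0 : Rp ≠ 0 := by linarith
  have hRm0 : Rm ≠ 0 := by linarith
  set iP : 𝔼 n → C.toCtx.Sl'.Level (C.toCtx.c + C.toCtx.σ) := (C.toCtx.disc' (one_pow 2)) ∘ scaleCLE n hRp0 with hiP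
  set iM : 𝔼 n → C.toCtx.Sl'.Level (C.toCtx.c + C.toCtx.σ) := (C.toCtx.disc' neg_one_sq) ∘ scaleCLE n hRm0 with hiM
  have hiPE : Manifold.IsSmoothEmbedding 𝓘(ℝ, 𝔼 n) (𝓡 n) ∞ iP := isSmoothEmbedding_comp_scale hipE hRp0
  have hiME : Manifold.IsSmoothEmbedding 𝓘(ℝ, 𝔼 n) (𝓡 n) ∞ iM := isSmoothEmbedding_comp_scale himE hRm0
  have hiPr : range iP = range (C.toCtx.disc' (one_pow 2)) := range_comp_scale (C.toCtx.disc' (one_pow 2)) hRp0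
  have hiMr : range iM = range (C.toCtx.disc' neg_one_sq) := range_comp_scale (C.toCtx.disc' neg_one_sq) hRm0
  have hiP0 : iP 0 = (C.toCtx.disc' (one_pow 2)) 0 := by show (C.toCtx.disc' (one_pow 2)) (Rp • (0 : 𝔼 n)) = (C.toCtx.disc' (one_pow 2)) 0; rw [smul_zero]
  have hiM0 : iM 0 = (C.toCtx.disc' neg_one_sq) 0 := by show (C.toCtx.disc' neg_one_sq) (Rm • (0 : 𝔼 n)) = (C.toCtx.disc' neg_one_sq) 0; rw [smul_zero]
  -- when `u` lies in the range of a disc, it lies in the enlarged closed disc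
  have huP : u ∈ range (C.toCtx.disc' (one_pow 2)) → u ∈ iP '' closedBall 0 1 := fun h => by
    have hw := h.choose_spec
    rw [← hw]
    refine apply_mem_image_comp_scale (C.toCtx.disc' (one_pow 2)) hRp1 ?_
    rw [hRp, dif_pos h]; exact le_max_right _ _
  have huM : u ∈ range (C.toCtx.disc' neg_one_sq) → u ∈ iM '' closedBall 0 1 := fun h => by
    have hw := h.choose_spec
    rw [← hw]
    refine apply_mem_image_comp_scale (C.toCtx.disc' neg_one_sq) hRm1 ?_
    rw [hRm, dif_pos h]; exact le_max_right _ _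
  -- the closed `-` disc and the open set of the push
  set Dm : Set (C.toCtx.Sl'.Level (C.toCtx.c + C.toCtx.σ)) := iM '' closedBall 0 1 with hDm
  have hDmc : IsCompact Dm := (isCompact_closedBall 0 1).image hiME.contMDiff.continuous
  have hDm_closed : IsClosed Dm := hDmc.isClosed
  have hDm_sub : Dm ⊆ range (C.toCtx.disc' neg_one_sq) := by rw [← hiMr]; exact image_subset_range _ _
  -- the obstacle set: `u` unless it lies in the range of one of the discs
  set Ob : Set (C.toCtx.Sl'.Level (C.toCtx.c + C.toCtx.σ)) := if u ∈ range (C.toCtx.disc' (one_pow 2)) ∪ range (C.toCtx.disc' neg_one_sq) then ∅ else {u} with hOb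
  have hOb_closed : IsClosed Ob := by rw [hOb]; split_ifs; exacts [isClosed_empty, isClosed_singleton]
  have hOb_fin : Ob.Finite := by rw [hOb]; split_ifs; exacts [finite_empty, finite_singleton u]
  have hOb_spec : ∀ z ∈ Ob, z = u ∧ u ∉ range (C.toCtx.disc' (one_pow 2)) ∧ u ∉ range (C.toCtx.disc' neg_one_sq) := by
    intro z hz; rw [hOb] at hz; split_ifs at hz with h
    · exact hz.elim
    · rw [mem_singleton_iff] at hz; exact ⟨hz, fun h' => h (Or.inl h'), fun h' => h (Or.inr h')⟩
  set U : Set (C.toCtx.Sl'.Level (C.toCtx.c + C.toCtx.σ)) := (Dm ∪ Ob)ᶜ with hU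
  have hUo : IsOpen U := (hDm_closed.union hOb_closed).isOpen_compl
  have hiPU : range iP ⊆ U := by
    rw [hiPr]; intro z hz hz'
    rcases hz' with hz' | hz'
    · exact Set.disjoint_iff.1 hdisj ⟨hz, hDm_sub hz'⟩
    · obtain ⟨hzu, hu, -⟩ := hOb_spec z hz'; rw [hzu] at hz; exact hu hz
  -- Step 1: move `β` off the finite set `{v₋} ∪ Ob`
  set F : Finset (C.toCtx.Sl'.Level (C.toCtx.c + C.toCtx.σ)) := insert ((C.toCtx.disc' neg_one_sq) 0) hOb_fin.toFinset with hF
  have hvF : (C.toCtx.disc' (one_pow 2)) 0 ∉ F := by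
    rw [hF, Finset.mem_insert]; rintro (h | h)
    · exact Set.disjoint_iff.1 hdisj ⟨⟨0, rfl⟩, ⟨0, h.symm⟩⟩
    · rw [Set.Finite.mem_toFinset] at h
      obtain ⟨h1, hu, -⟩ := hOb_spec _ h; exact hu ⟨0, h1⟩
  obtain ⟨β₁, hβ₁, -, hβ₁F⟩ := Path.exists_homotopic_range_subset_disjoint_finset hn isOpen_univ isPreconnected_univ β
    (subset_univ _) F hvF hvF
  -- Step 2: move `β₁` off the closed `-` disc
  have hp₁ : (C.toCtx.disc' (one_pow 2)) 0 ∉ range iM := by rw [hiMr]; exact fun h => Set.disjoint_iff.1 hdisj ⟨⟨0, rfl⟩, h⟩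
  have h0₁ : iM 0 ∉ range β₁ := by
    rw [hiM0]; intro h
    exact Set.disjoint_left.1 hβ₁F h (Finset.mem_coe.2 (by rw [hF]; exact Finset.mem_insert_self _ _))
  obtain ⟨β₂, hβ₂, hβ₂D, hβ₂off⟩ := Path.exists_homotopic_disjoint_image_closedBall hiME β₁ hp₁ hp₁ h0₁
  have hβ₂U : range β₂ ⊆ U := by
    intro z hz hz'
    rcases hz' with hz' | hz'
    · exact Set.disjoint_left.1 hβ₂D hz hz'
    · obtain ⟨hzu, hu, hum⟩ := hOb_spec z hz'
      rw [hzu] at hz hz'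
      have h1 : u ∈ range β₁ := (hβ₂off u (by rw [hiMr]; exact hum)).1 hz
      have h2 : u ∈ (F : Set (C.toCtx.Sl'.Level (C.toCtx.c + C.toCtx.σ))) := by
        rw [hF, Finset.coe_insert, Set.Finite.coe_toFinset]; exact Or.inr hz'
      exact Set.disjoint_left.1 hβ₁F h1 h2
  -- Step 3: push `v₊` around `β₂` with the enlarged `+` disc
  set β₃ : Path (iP 0) (iP 0) := β₂.cast hiP0 hiP0 with hβ₃
  have hβ₃U : range β₃ ⊆ U := by
    rintro _ ⟨s, rfl⟩; exact hβ₂U ⟨s, rfl⟩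
  set o₀' : Orientation ℝ (𝔼 n) (Fin (finrank ℝ (𝔼 n))) := (Module.finBasis ℝ (𝔼 n)).orientation with ho₀'
  have hiPo : IsOpen (range iP) := by rw [hiPr]; exact C.toCtx.isOpen_range_disc' (one_pow 2)
  obtain ⟨o₀, ho⟩ : ∃ o₀ : Orientation ℝ (𝔼 n) (Fin (finrank ℝ (𝔼 n))),
      IsOrientationPreserving (SmoothOrientation.modelSpace o₀) C.toCtx.oV' iP := by
    by_cases h : IsOrientationPreserving (SmoothOrientation.modelSpace o₀') C.toCtx.oV' iP
    · exact ⟨o₀', h⟩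
    · exact ⟨-o₀', (isOrientationPreserving_neg_iff_not hiPE hiPo C.toCtx.oV' o₀').2 h⟩
  obtain ⟨ψ, K, -, hKU, hψK, hψ1, h1, hhom⟩ := exists_diffeotopy_pointPush_closedBall hiPE ho hUo hiPU β₃ hβ₃U
  -- conclusions
  have hKm : ∀ z ∈ Dm, z ∉ K := fun z hz hzK => hKU hzK (Or.inl hz)
  have hfix_m : ∀ s w, ‖w‖ ≤ 1 → ψ.toFun s ((C.toCtx.disc' neg_one_sq) w) = (C.toCtx.disc' neg_one_sq) w := fun s w hw =>
    hψK s _ (hKm _ (image_closedBall_subset_image_comp_scale (C.toCtx.disc' neg_one_sq) hRm1 ⟨w, mem_closedBall_zero_iff.2 hw, rfl⟩))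
  have hfix_p : ∀ w, ‖w‖ ≤ 1 → ψ.toFun 1 ((C.toCtx.disc' (one_pow 2)) w) = (C.toCtx.disc' (one_pow 2)) w := fun w hw => by
    obtain ⟨w', hw', hww⟩ := image_closedBall_subset_image_comp_scale (C.toCtx.disc' (one_pow 2)) hRp1 ⟨w, mem_closedBall_zero_iff.2 hw, rfl⟩
    rw [← hww]; exact hψ1 w' (mem_closedBall_zero_iff.1 hw')
  have hu : ψ.toFun 1 u = u := by
    by_cases hup : u ∈ range (C.toCtx.disc' (one_pow 2))
    · obtain ⟨w', hw', hww⟩ := huP hup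
      rw [← hww]; exact hψ1 w' (mem_closedBall_zero_iff.1 hw')
    · by_cases hum : u ∈ range (C.toCtx.disc' neg_one_sq)
      · exact hψK 1 u (hKm u (huM hum))
      · refine hψK 1 u fun huK => hKU huK (Or.inr ?_)
        rw [hOb, if_neg (by rintro (h | h) <;> [exact hup h; exact hum h])]; exact mem_singleton u
  have hv : ψ.toFun 1 ((C.toCtx.disc' (one_pow 2)) 0) = (C.toCtx.disc' (one_pow 2)) 0 := hfix_p 0 (by simp)
  refine ⟨ψ, ⟨hfix_p, fun w hw => hfix_m 1 w hw⟩, fun s => hfix_m s 0 (by simp), hu, hv, ?_⟩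
  -- the track, transported along `iP 0 = (C.toCtx.disc' (one_pow 2)) 0`
  have key : ∀ (a : C.toCtx.Sl'.Level (C.toCtx.c + C.toCtx.σ)) (ha : a = (C.toCtx.disc' (one_pow 2)) 0) (γ : Path a a) (hγ : ∀ s, γ s = β₂ s) (ha1 : ψ.toFun 1 a = a)
      (hh : ((ψ.trackPath a).cast rfl ha1.symm).Homotopic γ),
      ∃ β' : Path ((C.toCtx.disc' (one_pow 2)) 0) ((C.toCtx.disc' (one_pow 2)) 0), (∀ s, β' s = ψ.toFun s ((C.toCtx.disc' (one_pow 2)) 0)) ∧ β'.Homotopic β := by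
    intro a ha γ hγ ha1 hh
    subst ha
    have hγ' : γ = β₂ := Path.ext (funext hγ)
    subst hγ'
    exact ⟨(ψ.trackPath ((C.toCtx.disc' (one_pow 2)) 0)).cast rfl ha1.symm, fun s => rfl, hh.trans (hβ₂.trans hβ₁)⟩
  exact key (iP 0) hiP0 β₃ (fun s => rfl) h1 hhom

end SlideContext

end Literature.Topology.FourManifolds
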